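import Literature.AnabelianGeometry.EtaleTheta.Discharge.Sec4Prop42SubRootsReading
import Literature.AnabelianGeometry.EtaleTheta.Discharge.Sec3Thm37Units
import HarnessLib

/-!
# [EtTh] Def. 4.1 (iv) / [FrdII] Def. 2.1 (i): `μ_N`-saturation of an object of a tempered Frobenioid is a property of the
# BASE DATA `(B(A^bs), Div_B)` alone; [FrdII] Rmk. 2.2.1 (the refinement law `hE` of Prop. 4.2 (iii), GAP G-w4d044-2) reduced
# to a base-level CYCLOTOMIC(–KUMMER) covering law

S. Mochizuki, *The étale theta function and its Frobenioid-theoretic manifestations*, Publ. RIMS **45** (2009)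
[MochizukiEtTh2009], §1 p.13 («`K_N := K(ζ_N, q_X^{1/N})`»), Def. 4.1 (iv) PDF p.87 («μ_N-saturated»), Prop. 4.2 (iii) PDF
p.88–90, proof p.90 l.10–11 («[Mzk18], Remark 2.2.1 [concerning the issue of (N, H)-saturation]») [cite: MochizukiEtTh2009,
Prop 4.2 p.88]; S. Mochizuki, *The geometry of Frobenioids II*, Kyushu J. Math. **62** (2008), Def. 2.1 (i) p.16 («`A` is
`μ_N`-saturated if the abstract group `μ_N(A)` is isomorphic to `ℤ/Nℤ`»), Rmk. 2.2.1 p.18; *Frobenioids I*, Thm. 5.2 (ii) p.101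
(`O^×(−)` on `C^birat` is `B`).

abc-iut cell, layer L2 [EtTh], DAG node `EtTh:Prop4.2(iii)` (residual of record, abc-iut-L2-lead R1035/R1058: «typed (iii) holds
at a constructed carrier only if … the base-field-theoretic rational functions carry roots of unity of every order reachable along
coverings»); seat abc-iut-w6-d037 (gen 6), row «P42III-hE-BASELEVEL».  PROOF-ONLY (0 `def`s, 0 instances, no `Prop`-valued
definition; nothing landed is edited or restated).  Consumed BY NAME: abc-iut-L1's `ModelFrobenioid.unitsToRatFn` /
`unitsToRatFn_injective` / `unitAut` / `divB_unitsToRatFn_eq_one` ([FrdI] Thm. 5.2 (ii) plumbing, `ModelFrobenioidUnits.lean`),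
abc-iut-w5-d164's `TemperedFrobenioid.unitsSubgroup_toElem_eq_units`, abc-iut-w4-d044's
`Prop42Sub.prop42_iii_mkOfModelCanonical_of_laws` / `prop42_iii_iv_mkOfModelCanonical_rootsReading` (p428253 / p428987) and
`ModelFrobenioid.isPullbackMorphism_of`.

## What is proved

§1 (ANY tempered Frobenioid `C`, `Φ(A^bs)` divisorial).  `TemperedFrobenioid.isMuSaturated_iff_ratFnTorsion`:
**`A` is `μ_N`-saturated ⟺ the `N`-torsion of `Ker(Div_B : B(A^bs)ˣ → Φ(A^bs)^gp)` is cyclic of order `N`** (generated by an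
element of order `N`).  Through [FrdI] Thm. 5.2 (ii) (`O^×(A) ↪ B(A^bs)ˣ`, image `= Ker Div_B`) the typed [FrdII] Def. 2.1 (i)
predicate `IsMuSaturated A N` (TORSION AUTOMORPHISMS of the Frobenioid object `A`) becomes a statement about the monoid
`B(A^bs)` of Def. 3.6 (ii) data ALONE, depending only on `A^bs` (`isMuSaturated_iff_of_base_eq`); sufficient forms on `B(A^bs)`
and on the Def. 3.6 (i) side `B₀^Λ(A^bs)` (`isMuSaturated_of_ratFn_generator`, `isMuSaturated_of_bZero_generator`).  The tree had
this toy by toy only (`ToyCst.isMuSaturated_of_generator`, `ToyTower…`, `ToyCovZ…`); the negative half is p492718.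
§2 (canonical §4 model `mkOfModelCanonical`).  `BiKummerSetting.Prop42Sub.refinementLaw_mkOfModelCanonical_of_cyclotomicLaw`:
the refinement law `hE` of [FrdII] Rmk. 2.2.1 (GAP-LEDGER G-w4d044-2; hypothesis of `prop42_iii_mkOfModelCanonical_of_laws`) —
until now a `C`-OBJECT-level law («∃ pull-back morphism `A″ → A′` with `A″` Galois, `μ_N`-saturated and `(N,H)`-good») — follows
from ONE law on the base data `(D, B, Div_B, IG)` and the `(N,H)`-slot `NH`:
`hμ : ∀ N, ∀ Y Galois, ∃ Galois Y′ → Y such that (a) the N-torsion of Ker Div_B(Y′) is cyclic of order N and (b) NH holds at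
every object over Y′` (the pull-back morphism is `(1, b, 0, 1)` of [FrdI] Thm. 5.2 (i)).
§3 COROLLARIES.  `Prop42Sub.prop42_iii_mkOfModelCanonical_of_cyclotomicLaw` — [EtTh] Prop. 4.2 (iii) AS TYPED at the canonical
model ⟸ {`Φ` divisorial, `hDSpull` ([FrdI] Prop. 4.1 (iii)), `hR` (E2 root law, G-w4d044-3), `hμ`, `hS` (Def. 4.1 (ii)
naturality)}; at the trivial slot `…_trivNH` clause (b) disappears; at the ROOTS READING
`prop42_iii_iv_mkOfModelCanonical_rootsReading_of_cyclotomicKummerLaw` — (iii) ∧ (iv) ⟸ {`Φ` divisorial, `hDSpull`, `hR`,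
`hμK`, `hS`} where `hμK` is the CYCLOTOMIC–KUMMER covering law «over some Galois `Y′ → Y`: `Ker Div_B(Y′)` has cyclic
`N`-torsion of order `N` AND every `Div_B`-trivial element of `B(A_⊙^bs)` is an `N`-th power in `B(Y′)`» — print's
`K_N = K(ζ_N, …)` / [FrdII] Rmk. 2.2.1's «Kummer theory of `K(μ_N, (O_K^×)^{1/N})`».  EVERY binder of these floors is now a
law on `(D, Φ, B, Div_B, IG, gS)`.  HONEST FRAMING: [EtTh]/[FrdI]/[FrdII] are refereed prerequisite papers; the laws are print's
own cited inputs BY NAME; GAP G-w4d044-2 stays OPEN at the faithful cohomological reading of `(N,H)`-saturation; nothing here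
bears on, or takes a side on, the disputed [IUTchIII] Cor. 3.12; nothing here asserts abc proved or refuted.
-/

noncomputable section

namespace Literature.AnabelianGeometry.EtaleTheta

open CategoryTheory Opposite Literature.AlgebraicGeometry.Frobenioids

universe u₀ v₀ u v w

/-! ## §1 `μ_N`-saturation through `O^×(A) ≅ Ker(Div_B : B(A^bs)ˣ → Φ^gp)` -/

namespace TemperedFrobenioid

variable {D₀ : Type u₀} [Category.{v₀} D₀] {V : FrdIMonoidStub.{w}} {T : RealifiedDivisorMonoids (D₀ := D₀) V}
  {D : Type u} [Category.{v} D] {VD : FrdICatStub.{u, v, w} D} (C : TemperedFrobenioid T D VD)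

/-- **`Ker Div_B ⊆ im(O^×(A) → B(A^bs)ˣ)`** ([FrdI] Thm. 5.2 (ii)): a unit rational function `u` on `A^bs` with `Div_B(u) = 0`
is `u_τ` for the base-identity linear automorphism `τ = (1, id, 0, u)` of `A`. [cite: MochizukiFrdI2008, Thm. 5.2(ii) p.101] -/
theorem exists_units_unitsToRatFn_eq (A : C.category) (u : (C.ratFnFunctor.obj (op A.base))ˣ)
    (hu : Literature.AlgebraicGeometry.Frobenioids.divB C.divisorMonoid C.ratFnFunctor C.divBNatTrans (op A.base)
      (u : C.ratFnFunctor.obj (op A.base)) = 1) :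
    ∃ τ : ModelFrobenioid.units A, ModelFrobenioid.unitsToRatFn A τ = u := by
  have hu' : Literature.AlgebraicGeometry.Frobenioids.divB C.divisorMonoid C.ratFnFunctor C.divBNatTrans (op A.base)
      ((u⁻¹ : (C.ratFnFunctor.obj (op A.base))ˣ) : C.ratFnFunctor.obj (op A.base)) = 1 := by
    have h : Literature.AlgebraicGeometry.Frobenioids.divB C.divisorMonoid C.ratFnFunctor C.divBNatTrans (op A.base)
        ((u⁻¹ : (C.ratFnFunctor.obj (op A.base))ˣ) : C.ratFnFunctor.obj (op A.base)) *
      Literature.AlgebraicGeometry.Frobenioids.divB C.divisorMonoid C.ratFnFunctor C.divBNatTrans (op A.base)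
        (u : C.ratFnFunctor.obj (op A.base)) = 1 := by
      rw [← map_mul, Units.inv_mul, map_one]
    rwa [hu, mul_one] at h
  refine ⟨⟨ModelFrobenioid.unitAut A 1 1 (u : C.ratFnFunctor.obj (op A.base))
      ((u⁻¹ : (C.ratFnFunctor.obj (op A.base))ˣ) : C.ratFnFunctor.obj (op A.base))
      (by rw [map_one, hu]) (by rw [map_one, hu']) (one_mul 1) (Units.inv_mul u),
    ModelFrobenioid.unitAut_mem_units _ _ _ _ _ _ _ _ _⟩, Units.ext rfl⟩

/-- Membership in `O^×(A)`: the [FrdI] Def. 1.2 (ii) subgroup for the structure functor of the tempered Frobenioid and L1's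
explicit `ModelFrobenioid.units A` have the same elements. [cite: MochizukiEtTh2009, Def 3.6 p.77] -/
theorem mem_units_iff_mem_modelUnits (A : C.category) (σ : Aut A) : σ ∈ C.units A ↔ σ ∈ ModelFrobenioid.units A :=
  SetLike.ext_iff.mp (C.unitsSubgroup_toElem_eq_units A) σ

/-- **[FrdII] Def. 2.1 (i) through [FrdI] Thm. 5.2 (ii): `A` is `μ_N`-saturated iff the `N`-torsion of
`Ker(Div_B : B(A^bs)ˣ → Φ(A^bs)^gp)` is cyclic of order `N`** (generated by an element `ζ` of order `N`) — for ANY tempered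
Frobenioid with `Φ(A^bs)` divisorial.  `μ_N(A) ⊆ O^×(A) ↪ B(A^bs)ˣ` is injective (`Φ` integral) with image `Ker Div_B` (`Φ` sharp +
`unitAut`), and group isomorphisms preserve «cyclic of order `N`».  So `μ_N`-saturation is a property of the Def. 3.6 (ii) datum
`(B(A^bs), Div_B)` — of the ROOTS OF UNITY among the rational functions on `A^bs` — not of the Frobenioid object.
[cite: MochizukiEtTh2009, Def 4.1 (iv) p.87] -/
theorem isMuSaturated_iff_ratFnTorsion (A : C.category) (hΦ : IsDivisorial (C.divisorMonoid.obj (op A.base))) (N : ℕ+) :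
    C.IsMuSaturated A N ↔
      ∃ ζ : (C.ratFnFunctor.obj (op A.base))ˣ,
        Literature.AlgebraicGeometry.Frobenioids.divB C.divisorMonoid C.ratFnFunctor C.divBNatTrans (op A.base)
            (ζ : C.ratFnFunctor.obj (op A.base)) = 1 ∧
          orderOf ζ = (N : ℕ) ∧
          ∀ u : (C.ratFnFunctor.obj (op A.base))ˣ,
            Literature.AlgebraicGeometry.Frobenioids.divB C.divisorMonoid C.ratFnFunctor C.divBNatTrans (op A.base)
                (u : C.ratFnFunctor.obj (op A.base)) = 1 →
              u ^ (N : ℕ) = 1 → u ∈ Subgroup.zpowers ζ := by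
  have hinj := ModelFrobenioid.unitsToRatFn_injective (X := A) hΦ.isPreDivisorial.isIntegral
  constructor
  · rintro ⟨σ, hσ, hord, hgen⟩
    let σu : ModelFrobenioid.units A := ⟨σ, (C.mem_units_iff_mem_modelUnits A σ).mp hσ.1⟩
    refine ⟨ModelFrobenioid.unitsToRatFn A σu, ModelFrobenioid.divB_unitsToRatFn_eq_one hΦ.isSharp σu, ?_, ?_⟩
    · rw [orderOf_injective _ hinj σu, ← Subgroup.orderOf_coe σu]
      exact hord
    · intro u hu huN
      obtain ⟨τu, hτu⟩ := C.exists_units_unitsToRatFn_eq A u hu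
      have hτN : τu ^ (N : ℕ) = 1 := hinj (by rw [map_pow, hτu, huN, map_one])
      have hτmu : (τu : Aut A) ∈ C.mu A N :=
        ⟨(C.mem_units_iff_mem_modelUnits A _).mpr τu.2, by rw [← Subgroup.coe_pow, hτN, Subgroup.coe_one]⟩
      obtain ⟨k, hk⟩ := Subgroup.mem_zpowers_iff.mp (hgen _ hτmu)
      have hk' : σu ^ k = τu := Subtype.ext (by rw [SubgroupClass.coe_zpow]; exact hk)
      exact Subgroup.mem_zpowers_iff.mpr ⟨k, by rw [← map_zpow, hk', hτu]⟩
  · rintro ⟨ζ, hζ1, hζord, hζgen⟩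
    obtain ⟨σu, hσu⟩ := C.exists_units_unitsToRatFn_eq A ζ hζ1
    have hσN : σu ^ (N : ℕ) = 1 := hinj (by rw [map_pow, hσu, map_one, ← hζord]; exact pow_orderOf_eq_one ζ)
    refine ⟨(σu : Aut A), ⟨(C.mem_units_iff_mem_modelUnits A _).mpr σu.2,
      by rw [← Subgroup.coe_pow, hσN, Subgroup.coe_one]⟩, ?_, ?_⟩
    · rw [Subgroup.orderOf_coe, ← orderOf_injective _ hinj σu, hσu]
      exact hζord
    · rintro τ ⟨hτu, hτN⟩
      let τu : ModelFrobenioid.units A := ⟨τ, (C.mem_units_iff_mem_modelUnits A τ).mp hτu⟩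
      have hτuN : τu ^ (N : ℕ) = 1 := Subtype.ext (by rw [Subgroup.coe_pow, Subgroup.coe_one]; exact hτN)
      have h1 : ModelFrobenioid.unitsToRatFn A τu ^ (N : ℕ) = 1 := by rw [← map_pow, hτuN, map_one]
      obtain ⟨k, hk⟩ := Subgroup.mem_zpowers_iff.mp
        (hζgen _ (ModelFrobenioid.divB_unitsToRatFn_eq_one hΦ.isSharp τu) h1)
      have hk' : σu ^ k = τu := hinj (by rw [map_zpow, hσu, hk])
      exact Subgroup.mem_zpowers_iff.mpr ⟨k, by rw [← SubgroupClass.coe_zpow, hk']⟩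

/-- **`μ_N`-saturation depends only on the base `A^bs`**: two objects of the tempered Frobenioid over the same object `Y` of `D`
(arbitrary «line bundles» `c`, `c'`) are `μ_N`-saturated together. [cite: MochizukiEtTh2009, Def 4.1 (iv) p.87] -/
theorem isMuSaturated_iff_of_base_eq (Y : D) (hΦ : IsDivisorial (C.divisorMonoid.obj (op Y)))
    (c c' : Algebra.GrothendieckGroup (C.divisorMonoid.obj (op Y))) (N : ℕ+) :
    C.IsMuSaturated ⟨Y, c⟩ N ↔ C.IsMuSaturated ⟨Y, c'⟩ N :=
  (C.isMuSaturated_iff_ratFnTorsion ⟨Y, c⟩ hΦ N).trans (C.isMuSaturated_iff_ratFnTorsion ⟨Y, c'⟩ hΦ N).symm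

/-- **Sufficient base-level condition** (the `⟸` half, the form the model carriers discharge): a `Div_B`-trivial unit rational
function `ζ` on `A^bs` of order `N` such that every `Div_B`-trivial `u` with `u^N = 1` is a power of `ζ` makes `A`
`μ_N`-saturated. [cite: MochizukiEtTh2009, Def 4.1 (iv) p.87] -/
theorem isMuSaturated_of_ratFn_generator (A : C.category) (hΦ : IsDivisorial (C.divisorMonoid.obj (op A.base))) (N : ℕ+)
    (ζ : (C.ratFnFunctor.obj (op A.base))ˣ)
    (hζ1 : Literature.AlgebraicGeometry.Frobenioids.divB C.divisorMonoid C.ratFnFunctor C.divBNatTrans (op A.base)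
      (ζ : C.ratFnFunctor.obj (op A.base)) = 1)
    (hζord : orderOf ζ = (N : ℕ))
    (hζgen : ∀ u : (C.ratFnFunctor.obj (op A.base))ˣ,
      Literature.AlgebraicGeometry.Frobenioids.divB C.divisorMonoid C.ratFnFunctor C.divBNatTrans (op A.base)
          (u : C.ratFnFunctor.obj (op A.base)) = 1 →
        u ^ (N : ℕ) = 1 → u ∈ Subgroup.zpowers ζ) :
    C.IsMuSaturated A N :=
  (C.isMuSaturated_iff_ratFnTorsion A hΦ N).mpr ⟨ζ, hζ1, hζord, hζgen⟩

/-- **The same criterion on the Def. 3.6 (i) side `B₀^Λ(A^bs)`** (the form a model carrier discharges directly on its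
function monoid): a unit `ζ₀ ∈ Ker(B₀^Λ(A^bs)ˣ → (Φ₀^ℝ)^gp)` of order `N` such that every `b` in that kernel with `b^N = 1` is a
power of `ζ₀` makes `A` `μ_N`-saturated — transported to `B(A^bs) = B₀^Λ ×_{(Φ^{ℝ-log})^gp} Φ^gp` as `ζ := (ζ₀, 0)`; on `Ker Div_B`
the first projection is injective. [cite: MochizukiEtTh2009, Def 4.1 (iv) p.87] -/
theorem isMuSaturated_of_bZero_generator (A : C.category) (hΦ : IsDivisorial (C.divisorMonoid.obj (op A.base))) (N : ℕ+)
    (ζ₀ : (T.BΛ.obj (C.baseOp (op A.base)))ˣ)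
    (hζ1 : T.divΛ (C.baseOp (op A.base)) (ζ₀ : T.BΛ.obj (C.baseOp (op A.base))) = 1) (hord : orderOf ζ₀ = (N : ℕ))
    (hgen : ∀ b : (T.BΛ.obj (C.baseOp (op A.base)))ˣ,
      T.divΛ (C.baseOp (op A.base)) (b : T.BΛ.obj (C.baseOp (op A.base))) = 1 → b ^ (N : ℕ) = 1 →
        b ∈ Subgroup.zpowers ζ₀) :
    C.IsMuSaturated A N := by
  -- membership of `(b, 0)` in the fibre product `B(A^bs)` for `b` in the kernel
  have mem : ∀ b : (T.BΛ.obj (C.baseOp (op A.base)))ˣ,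
      T.divΛ (C.baseOp (op A.base)) (b : T.BΛ.obj (C.baseOp (op A.base))) = 1 →
        ((b : T.BΛ.obj (C.baseOp (op A.base))), (1 : Algebra.GrothendieckGroup (C.Φ.carrier (op A.base)))) ∈
          C.ratFn (op A.base) := fun b hb => by
    change T.divΛ (C.baseOp (op A.base)) (b : T.BΛ.obj (C.baseOp (op A.base))) = C.ΦgpToRlog (op A.base) 1
    rw [map_one]
    exact hb
  have hζ1' : T.divΛ (C.baseOp (op A.base))
      ((ζ₀⁻¹ : (T.BΛ.obj (C.baseOp (op A.base)))ˣ) : T.BΛ.obj (C.baseOp (op A.base))) = 1 := by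
    have h : T.divΛ (C.baseOp (op A.base))
        ((ζ₀⁻¹ : (T.BΛ.obj (C.baseOp (op A.base)))ˣ) : T.BΛ.obj (C.baseOp (op A.base))) *
      T.divΛ (C.baseOp (op A.base)) (ζ₀ : T.BΛ.obj (C.baseOp (op A.base))) = 1 := by
      rw [← map_mul, Units.inv_mul, map_one]
    rwa [hζ1, mul_one] at h
  let z : C.ratFn (op A.base) := ⟨_, mem ζ₀ hζ1⟩
  let z' : C.ratFn (op A.base) := ⟨_, mem ζ₀⁻¹ hζ1'⟩
  let ζ : (C.ratFnFunctor.obj (op A.base))ˣ :=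
    Units.mkOfMulEqOne (z : C.ratFnFunctor.obj (op A.base)) (z' : C.ratFnFunctor.obj (op A.base))
      (Subtype.ext (Prod.ext (Units.mul_inv ζ₀) (mul_one 1)))
  -- the first projection `B(A^bs)ˣ → B₀^Λ(A^bs)ˣ` and `Div_B` on units, as homomorphisms
  let f : (C.ratFnFunctor.obj (op A.base))ˣ →* (T.BΛ.obj (C.baseOp (op A.base)))ˣ :=
    Units.map ((MonoidHom.fst _ _).comp (C.ratFn (op A.base)).subtype)
  let g : (C.ratFnFunctor.obj (op A.base))ˣ →* Algebra.GrothendieckGroup (C.Φ.carrier (op A.base)) :=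
    (Literature.AlgebraicGeometry.Frobenioids.divB C.divisorMonoid C.ratFnFunctor C.divBNatTrans (op A.base)).comp
      (Units.coeHom _)
  have hg : ∀ u : (C.ratFnFunctor.obj (op A.base))ˣ,
      Literature.AlgebraicGeometry.Frobenioids.divB C.divisorMonoid C.ratFnFunctor C.divBNatTrans (op A.base)
        (u : C.ratFnFunctor.obj (op A.base)) = g u := fun _ => rfl
  have hfζ : f ζ = ζ₀ := Units.ext rfl
  have hgζ : g ζ = 1 := rfl
  -- on `Ker Div_B` the first projection is injective
  have hinjf : ∀ u u' : (C.ratFnFunctor.obj (op A.base))ˣ, g u = 1 → g u' = 1 → f u = f u' → u = u' := by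
    intro u u' hu hu' h
    apply Units.ext
    apply Subtype.ext
    exact Prod.ext (congrArg (fun x : (T.BΛ.obj (C.baseOp (op A.base)))ˣ => (x : T.BΛ.obj (C.baseOp (op A.base)))) h)
      (hu.trans hu'.symm)
  refine C.isMuSaturated_of_ratFn_generator A hΦ N ζ hgζ ?_ ?_
  · -- `orderOf ζ = orderOf ζ₀`: `ζ^n = 1 ↔ ζ₀^n = 1`
    rw [← hord]
    refine orderOf_eq_orderOf_iff.mpr fun n => ⟨fun h => ?_, fun h => ?_⟩
    · rw [← hfζ, ← map_pow, h, map_one]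
    · exact hinjf _ _ (by rw [map_pow, hgζ, one_pow]) (map_one g) (by rw [map_pow, hfζ, h, map_one])
  · intro u hu huN
    rw [hg] at hu
    have hb1 : T.divΛ (C.baseOp (op A.base)) (f u : T.BΛ.obj (C.baseOp (op A.base))) = 1 := by
      have h2 := ((u : C.ratFnFunctor.obj (op A.base)) : C.ratFn (op A.base)).2
      have h3 : C.ΦgpToRlog (op A.base) (g u) = 1 := by rw [hu]; exact map_one _
      exact h2.trans h3
    have hbN : f u ^ (N : ℕ) = 1 := by rw [← map_pow, huN, map_one]
    obtain ⟨k, hk⟩ := Subgroup.mem_zpowers_iff.mp (hgen (f u) hb1 hbN)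
    exact Subgroup.mem_zpowers_iff.mpr
      ⟨k, hinjf _ _ (by rw [map_zpow, hgζ, one_zpow]) hu (by rw [map_zpow, hfζ, hk])⟩

end TemperedFrobenioid

/-! ## §2 The refinement law `hE` of [FrdII] Rmk. 2.2.1 at the canonical model from a base-level cyclotomic law -/

namespace BiKummerSetting

section Canonical

variable {K : Type u₀} [Field K] (X : SemiGraphs.TemperedArithmeticGroup.{u₀} K) {D₀ : Type u₀}
  [Category.{v₀} D₀] {V : FrdIMonoidStub.{w}} {T : RealifiedDivisorMonoids (D₀ := D₀) V}
  {D : Type u} [Category.{v} D] {VD : FrdICatStub.{u, v, w} D}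
  (tf : TemperedFrobenioid T D VD) (hZ : tf.monoidType = MonoidType.Z)
  (hP : ∀ A : Dᵒᵖ, IsPerfect (tf.Φ.carrier A)) (IG : D → Prop) (gS : ∀ A : D, IG A → (X.Pi →* Aut A))
  (gSs : ∀ (A : D) (h : IG A), Function.Surjective (gS A h))
  (NH : Subgroup (Field.absoluteGaloisGroup K) → tf.category → ℕ+ → Prop) (A₀ : tf.category)
  (hA₀ : PreFrobenioid.IsFrobeniusTrivial tf.toElem A₀) (hA₀' : IG A₀.base)

/-- **GAP G-w4d044-2 (`hE`, [FrdII] Rmk. 2.2.1) at the canonical model ⟸ the base-level CYCLOTOMIC COVERING LAW `hμ`**: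
if every Galois `Y` admits a Galois `b : Y′ → Y` such that (a) the `N`-torsion of `Ker Div_B(Y′)` is cyclic of order `N` and
(b) the `(N,H)`-slot `NH` holds at every object of `C` over `Y′`, then every `A′` with Galois base admits the pull-back morphism
`(1, b, 0, 1) : A″ := (Y′, b^*[A′]) → A′` ([FrdI] Thm. 5.2 (i)) with `A″` Galois-based, `μ_N`-saturated (§1) and `(N,H)`-good — the
hypothesis `hE` of `Prop42Sub.prop42_iii_mkOfModelCanonical_of_laws` (p428253). [cite: MochizukiEtTh2009, Prop 4.2 (iii) p.90] -/
theorem Prop42Sub.refinementLaw_mkOfModelCanonical_of_cyclotomicLaw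
    (hΦd : Objectwise (fun M _ => IsDivisorial M) tf.divisorMonoid)
    (hμ : ∀ (N : ℕ+) (Y : D), IG Y → ∃ (Y' : D) (_ : IG Y') (_ : Y' ⟶ Y),
      (∃ ζ : (tf.ratFnFunctor.obj (op Y'))ˣ,
        Literature.AlgebraicGeometry.Frobenioids.divB tf.divisorMonoid tf.ratFnFunctor tf.divBNatTrans (op Y')
            (ζ : tf.ratFnFunctor.obj (op Y')) = 1 ∧
          orderOf ζ = (N : ℕ) ∧
          ∀ u : (tf.ratFnFunctor.obj (op Y'))ˣ,
            Literature.AlgebraicGeometry.Frobenioids.divB tf.divisorMonoid tf.ratFnFunctor tf.divBNatTrans (op Y')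
                (u : tf.ratFnFunctor.obj (op Y')) = 1 →
              u ^ (N : ℕ) = 1 → u ∈ Subgroup.zpowers ζ) ∧
      ∀ c : Algebra.GrothendieckGroup (tf.divisorMonoid.obj (op Y')),
        NH (mkOfModelCanonical X tf hZ hP IG gS gSs NH A₀ hA₀ hA₀').HodotBsFld ⟨Y', c⟩ N) :
    ∀ (N : ℕ+) (A' : tf.category), PreFrobenioid.IsFrobeniusTrivial tf.toElem A' → IG A'.base →
      ∃ (A'' : tf.category) (ψ : A'' ⟶ A'), PreFrobenioid.IsPullbackMorphism tf.toElem ψ ∧ IG A''.base ∧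
        tf.IsMuSaturated A'' N ∧ NH (mkOfModelCanonical X tf hZ hP IG gS gSs NH A₀ hA₀ hA₀').HodotBsFld A'' N := by
  intro N A' _ hA'
  obtain ⟨Y', hY', b, hcyc, hNH⟩ := hμ N A'.base hA'
  have hBg := tf.isGroupLike_ratFnFunctor T.isUnit_BΛ
  let W : tf.category := ⟨Y', pullGp tf.divisorMonoid b A'.cls⟩
  let δ : W ⟶ A' := ModelFrobenioid.mkHom W A' 1 b 1 1 (by
    rw [PNat.one_coe, pow_one, map_one, mul_one, map_one, mul_one])
  exact ⟨W, δ, ModelFrobenioid.isPullbackMorphism_of hΦd hBg rfl rfl, hY',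
    (tf.isMuSaturated_iff_ratFnTorsion W (hΦd Y') N).mpr hcyc, hNH _⟩

/-! ## §3 [EtTh] Prop. 4.2 (iii) (and (iii) ∧ (iv) at the roots reading) at the canonical model from base-level laws only -/

/-- **[EtTh] Prop. 4.2 (iii) AS TYPED at the canonical model, EVERY binder a law on the base data**: `Φ` divisorial, the
[FrdI] Prop. 4.1 (iii) coprimality-pull-back law `hDSpull`, the tempered-meromorphic root law `hR` (ERRATUM E2, G-w4d044-3), the
cyclotomic covering law `hμ` (with the `NH`-clause (b) for a general slot) and the Def. 4.1 (ii) naturality law `hS` —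
`prop42_iii_mkOfModelCanonical_of_laws` with `hE := refinementLaw_mkOfModelCanonical_of_cyclotomicLaw hμ`.
[cite: MochizukiEtTh2009, Prop 4.2 (iii) p.88] -/
theorem Prop42Sub.prop42_iii_mkOfModelCanonical_of_cyclotomicLaw
    (hΦd : Objectwise (fun M _ => IsDivisorial M) tf.divisorMonoid)
    (hDSpull : ∀ {A A' : D} (e : A' ⟶ A) {a b : tf.Φ.carrier (op A)},
      (∀ x : tf.Φ.carrier (op A), x ∣ a → x ∣ b → x = 1) →
        ∀ y : tf.Φ.carrier (op A'), y ∣ pull tf.divisorMonoid e a → y ∣ pull tf.divisorMonoid e b → y = 1)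
    (hR : ∀ (N : ℕ+) (A : D), IG A → ∀ f : tf.ratFnFunctor.obj (op A),
      ∃ (A' : D) (_ : IG A') (b : A' ⟶ A) (g : tf.ratFnFunctor.obj (op A')),
        g ^ (N : ℕ) = pull tf.ratFnFunctor b f)
    (hμ : ∀ (N : ℕ+) (Y : D), IG Y → ∃ (Y' : D) (_ : IG Y') (_ : Y' ⟶ Y),
      (∃ ζ : (tf.ratFnFunctor.obj (op Y'))ˣ,
        Literature.AlgebraicGeometry.Frobenioids.divB tf.divisorMonoid tf.ratFnFunctor tf.divBNatTrans (op Y')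
            (ζ : tf.ratFnFunctor.obj (op Y')) = 1 ∧
          orderOf ζ = (N : ℕ) ∧
          ∀ u : (tf.ratFnFunctor.obj (op Y'))ˣ,
            Literature.AlgebraicGeometry.Frobenioids.divB tf.divisorMonoid tf.ratFnFunctor tf.divBNatTrans (op Y')
                (u : tf.ratFnFunctor.obj (op Y')) = 1 →
              u ^ (N : ℕ) = 1 → u ∈ Subgroup.zpowers ζ) ∧
      ∀ c : Algebra.GrothendieckGroup (tf.divisorMonoid.obj (op Y')),
        NH (mkOfModelCanonical X tf hZ hP IG gS gSs NH A₀ hA₀ hA₀').HodotBsFld ⟨Y', c⟩ N)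
    (hS : ∀ ⦃A B : D⦄ (hA : IG A) (hB : IG B) (b : B ⟶ A),
      ∃ c : X.Pi, ∀ g : X.Pi, (gS B hB g).hom ≫ b = b ≫ (gS A hA (c * g * c⁻¹)).hom) :
    (mkOfModelCanonical X tf hZ hP IG gS gSs NH A₀ hA₀ hA₀').Prop42_iii (fun {_ _} φ x => tf.pullFracModel φ x) :=
  Prop42Sub.prop42_iii_mkOfModelCanonical_of_laws X tf hZ hP IG gS gSs NH A₀ hA₀ hA₀' hΦd hDSpull hR
    (Prop42Sub.refinementLaw_mkOfModelCanonical_of_cyclotomicLaw X tf hZ hP IG gS gSs NH A₀ hA₀ hA₀' hΦd hμ) hS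

/-- **[EtTh] Prop. 4.2 (iii) AS TYPED at the canonical model with the TRIVIAL `(N,H)`-slot** (`NH := True`, the reading of the
tree's tower non-vacuity witnesses `thm44_…_trivNH`): ⟸ {`Φ` divisorial, `hDSpull`, `hR`, `hμ₀`, `hS`} with `hμ₀` the PURE
cyclotomic covering law «every Galois `Y` has a Galois `Y′ → Y` over which `Ker Div_B` has cyclic `N`-torsion of order `N`»
(print's `K_N ∋ ζ_N`, §1 p.13). [cite: MochizukiEtTh2009, Prop 4.2 (iii) p.88] -/
theorem Prop42Sub.prop42_iii_mkOfModelCanonical_trivNH_of_cyclotomicLaw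
    (hΦd : Objectwise (fun M _ => IsDivisorial M) tf.divisorMonoid)
    (hDSpull : ∀ {A A' : D} (e : A' ⟶ A) {a b : tf.Φ.carrier (op A)},
      (∀ x : tf.Φ.carrier (op A), x ∣ a → x ∣ b → x = 1) →
        ∀ y : tf.Φ.carrier (op A'), y ∣ pull tf.divisorMonoid e a → y ∣ pull tf.divisorMonoid e b → y = 1)
    (hR : ∀ (N : ℕ+) (A : D), IG A → ∀ f : tf.ratFnFunctor.obj (op A),
      ∃ (A' : D) (_ : IG A') (b : A' ⟶ A) (g : tf.ratFnFunctor.obj (op A')),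
        g ^ (N : ℕ) = pull tf.ratFnFunctor b f)
    (hμ₀ : ∀ (N : ℕ+) (Y : D), IG Y → ∃ (Y' : D) (_ : IG Y') (_ : Y' ⟶ Y),
      ∃ ζ : (tf.ratFnFunctor.obj (op Y'))ˣ,
        Literature.AlgebraicGeometry.Frobenioids.divB tf.divisorMonoid tf.ratFnFunctor tf.divBNatTrans (op Y')
            (ζ : tf.ratFnFunctor.obj (op Y')) = 1 ∧
          orderOf ζ = (N : ℕ) ∧
          ∀ u : (tf.ratFnFunctor.obj (op Y'))ˣ,
            Literature.AlgebraicGeometry.Frobenioids.divB tf.divisorMonoid tf.ratFnFunctor tf.divBNatTrans (op Y')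
                (u : tf.ratFnFunctor.obj (op Y')) = 1 →
              u ^ (N : ℕ) = 1 → u ∈ Subgroup.zpowers ζ)
    (hS : ∀ ⦃A B : D⦄ (hA : IG A) (hB : IG B) (b : B ⟶ A),
      ∃ c : X.Pi, ∀ g : X.Pi, (gS B hB g).hom ≫ b = b ≫ (gS A hA (c * g * c⁻¹)).hom) :
    (mkOfModelCanonical X tf hZ hP IG gS gSs (fun _ _ _ => True) A₀ hA₀ hA₀').Prop42_iii
      (fun {_ _} φ x => tf.pullFracModel φ x) :=
  Prop42Sub.prop42_iii_mkOfModelCanonical_of_cyclotomicLaw X tf hZ hP IG gS gSs (fun _ _ _ => True) A₀ hA₀ hA₀'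
    hΦd hDSpull hR
    (fun N Y hY => by
      obtain ⟨Y', hY', b, hcyc⟩ := hμ₀ N Y hY
      exact ⟨Y', hY', b, hcyc, fun _ => trivial⟩)
    hS

/-- **[EtTh] Prop. 4.2 (iii) ∧ (iv) AS TYPED at the canonical model AT THE ROOTS READING of the `(N, H_⊙^{bs-fld})`-slot, every
binder a law on the base data**: `Φ` divisorial, `hDSpull`, `hR` (E2), `hS`, and the CYCLOTOMIC–KUMMER COVERING LAW `hμK` —
«every Galois `Y` has a Galois `Y′ → Y` over which (a) `Ker Div_B(Y′)` has cyclic `N`-torsion of order `N` and (b) every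
`Div_B`-trivial element of `B(A_⊙^bs)` becomes an `N`-th power along every `Y′ → A_⊙^bs`» (print's `K_N := K(ζ_N, …)`, §1 p.13;
[FrdII] Rmk. 2.2.1 «after pull-back to an (N,H)-saturated object»: the Kummer extension `K(μ_N, (O_K^×)^{1/N})`).
Corollary of abc-iut-w4-d044's `prop42_iii_iv_mkOfModelCanonical_rootsReading` (p428987) with its `C`-object-level
Kummer-cover law `hK` PRODUCED from `hμK` by §2. [cite: MochizukiEtTh2009, Prop 4.2 p.88] -/
theorem Prop42Sub.prop42_iii_iv_mkOfModelCanonical_rootsReading_of_cyclotomicKummerLaw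
    (hΦd : Objectwise (fun M _ => IsDivisorial M) tf.divisorMonoid)
    (hDSpull : ∀ {A A' : D} (e : A' ⟶ A) {a b : tf.Φ.carrier (op A)},
      (∀ x : tf.Φ.carrier (op A), x ∣ a → x ∣ b → x = 1) →
        ∀ y : tf.Φ.carrier (op A'), y ∣ pull tf.divisorMonoid e a → y ∣ pull tf.divisorMonoid e b → y = 1)
    (hR : ∀ (N : ℕ+) (A : D), IG A → ∀ f : tf.ratFnFunctor.obj (op A),
      ∃ (A' : D) (_ : IG A') (b : A' ⟶ A) (g : tf.ratFnFunctor.obj (op A')),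
        g ^ (N : ℕ) = pull tf.ratFnFunctor b f)
    (hμK : ∀ (N : ℕ+) (Y : D), IG Y → ∃ (Y' : D) (_ : IG Y') (_ : Y' ⟶ Y),
      (∃ ζ : (tf.ratFnFunctor.obj (op Y'))ˣ,
        Literature.AlgebraicGeometry.Frobenioids.divB tf.divisorMonoid tf.ratFnFunctor tf.divBNatTrans (op Y')
            (ζ : tf.ratFnFunctor.obj (op Y')) = 1 ∧
          orderOf ζ = (N : ℕ) ∧
          ∀ u : (tf.ratFnFunctor.obj (op Y'))ˣ,
            Literature.AlgebraicGeometry.Frobenioids.divB tf.divisorMonoid tf.ratFnFunctor tf.divBNatTrans (op Y')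
                (u : tf.ratFnFunctor.obj (op Y')) = 1 →
              u ^ (N : ℕ) = 1 → u ∈ Subgroup.zpowers ζ) ∧
      ∀ (b₀ : Y' ⟶ A₀.base) (x : tf.ratFnFunctor.obj (op A₀.base)),
        Literature.AlgebraicGeometry.Frobenioids.divB tf.divisorMonoid tf.ratFnFunctor tf.divBNatTrans (op A₀.base) x = 1 →
          ∃ ζ : tf.ratFnFunctor.obj (op Y'), ζ ^ (N : ℕ) = pull tf.ratFnFunctor b₀ x)
    (hS : ∀ ⦃A B : D⦄ (hA : IG A) (hB : IG B) (b : B ⟶ A),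
      ∃ c : X.Pi, ∀ g : X.Pi, (gS B hB g).hom ≫ b = b ≫ (gS A hA (c * g * c⁻¹)).hom) :
    (mkOfModelCanonical X tf hZ hP IG gS gSs
        (fun _ A M => ∀ (b : A.base ⟶ A₀.base) (x : tf.ratFnFunctor.obj (op A₀.base)),
          Literature.AlgebraicGeometry.Frobenioids.divB tf.divisorMonoid tf.ratFnFunctor tf.divBNatTrans (op A₀.base) x = 1 →
            ∃ ζ : tf.ratFnFunctor.obj (op A.base), ζ ^ (M : ℕ) = pull tf.ratFnFunctor b x)
        A₀ hA₀ hA₀').Prop42_iii (fun {_ _} φ x => tf.pullFracModel φ x) ∧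
      (mkOfModelCanonical X tf hZ hP IG gS gSs
        (fun _ A M => ∀ (b : A.base ⟶ A₀.base) (x : tf.ratFnFunctor.obj (op A₀.base)),
          Literature.AlgebraicGeometry.Frobenioids.divB tf.divisorMonoid tf.ratFnFunctor tf.divBNatTrans (op A₀.base) x = 1 →
            ∃ ζ : tf.ratFnFunctor.obj (op A.base), ζ ^ (M : ℕ) = pull tf.ratFnFunctor b x)
        A₀ hA₀ hA₀').Prop42_iv (fun φ x => tf.pullFracModel φ x) :=
  Prop42Sub.prop42_iii_iv_mkOfModelCanonical_rootsReading X tf hZ hP IG gS gSs A₀ hA₀ hA₀' hΦd hDSpull hR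
    (Prop42Sub.refinementLaw_mkOfModelCanonical_of_cyclotomicLaw X tf hZ hP IG gS gSs
      (fun _ A M => ∀ (b : A.base ⟶ A₀.base) (x : tf.ratFnFunctor.obj (op A₀.base)),
        Literature.AlgebraicGeometry.Frobenioids.divB tf.divisorMonoid tf.ratFnFunctor tf.divBNatTrans (op A₀.base) x = 1 →
          ∃ ζ : tf.ratFnFunctor.obj (op A.base), ζ ^ (M : ℕ) = pull tf.ratFnFunctor b x)
      A₀ hA₀ hA₀' hΦd
      (fun N Y hY => by
        obtain ⟨Y', hY', b, hcyc, hkum⟩ := hμK N Y hY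
        exact ⟨Y', hY', b, hcyc, fun _ => hkum⟩))
    hS

end Canonical

end BiKummerSetting

end Literature.AnabelianGeometry.EtaleTheta

end
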